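import Literature.NumberTheory.LFunctions.FordIncompleteS4W
import Literature.NumberTheory.LFunctions.FordIncompleteS3Inject
import Literature.NumberTheory.LFunctions.FordIncompleteHolder
import HarnessLib

/-!
# Ford's Lemma 4.1, case `S₄` (the main term)

Topic `Literature/NumberTheory/LFunctions`. Everything here is PROVED.

K. Ford, Proc. LMS 85 (2002), proof of Lemma 4.1, case `S₄`: when no rest variable is special,
each `x_i` (`i > t`) has a divisor `q_i ∈ (Q, QR]` with `(q_i, J(x)) = 1` (the largest divisor coprime
to `J(x)` exceeds `Q`; peel primes to get a minimal one). Writing `x_i = q_i u_i`, the solutions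
inject into a union over `(q_1,…,q_m; p_1,…,p_m)` of systems counted by
`∫ F_{q̃} ∏ f_i · conj(F_{p̃} ∏ g_i)`; Hölder with `2m` factors and the monotonicity of counts in the
index set give `S₄ ≤ (∑_q W(q)^{1/2m})^{2m}`.

## References

* K. Ford, Proc. London Math. Soc. (3) 85 (2002), 565–633, proof of Lemma 4.1 (case S₄, (4.8)).
  [Ford2002]
-/

noncomputable section

open Finset MeasureTheory
open scoped Real

namespace Literature.NumberTheory.LFunctions
namespace FordVK

open VMV FordSmooth

/-! ### Good divisors of non-special numbers -/

/-- **The largest divisor coprime to `J` exceeds `Q` for a non-special `n`.**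
[cite: Ford2002, proof of Lemma 4.1 ("let q be the greatest divisor of x_i with (q, J(x)) = 1. If
q ≤ P^{1/r} then x_i 𝒟(P^{1/r}) J(x), a contradiction")] -/
theorem exists_coprime_divisor_gt {n J Qn : ℕ} (hn : n ≠ 0) (hJ : J ≠ 0) (hns : ¬ Special Qn J n) :
    ∃ q₀, q₀ ∣ n ∧ Qn < q₀ ∧ Nat.Coprime q₀ J := by
  classical
  set Adm := n.divisors.filter fun d => Nat.Coprime d J with hAdm
  have hne : Adm.Nonempty := ⟨1, by rw [hAdm, mem_filter]; exact ⟨Nat.one_mem_divisors.2 hn, Nat.coprime_one_left _⟩⟩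
  set q₀ := Adm.max' hne with hq₀
  have hmem : q₀ ∈ Adm := Finset.max'_mem _ _
  rw [hAdm, mem_filter] at hmem
  obtain ⟨hdiv, hcop⟩ := hmem
  have hq₀n := Nat.dvd_of_mem_divisors hdiv
  refine ⟨q₀, hq₀n, ?_, hcop⟩
  by_contra hle
  push Not at hle
  apply hns
  refine ⟨q₀, hdiv, hle, ?_⟩
  -- every prime factor of `n / q₀` divides `J`
  rw [rad_dvd_iff hJ]
  intro p hp
  have hpp := Nat.prime_of_mem_primeFactors hp
  have hpdvd := Nat.dvd_of_mem_primeFactors hp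
  rw [Nat.mem_primeFactors]
  refine ⟨hpp, ?_, hJ⟩
  by_contra hpJ
  have hcopp : Nat.Coprime p J := (Nat.Prime.coprime_iff_not_dvd hpp).2 hpJ
  have hmul : q₀ * p ∣ n := Nat.mul_dvd_of_dvd_div hq₀n hpdvd
  have hmem' : q₀ * p ∈ Adm := by
    rw [hAdm, mem_filter, Nat.mem_divisors]
    exact ⟨⟨hmul, hn⟩, Nat.Coprime.mul_left hcop hcopp⟩
  have hle' : q₀ * p ≤ q₀ := Finset.le_max' _ _ hmem'
  have hq0 : 0 < q₀ := Nat.pos_of_mem_divisors hdiv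
  have : p ≤ 1 := by nlinarith [hpp.two_le]
  exact absurd this (by have := hpp.two_le; omega)

/-- **A minimal good divisor**: `q ∣ n`, `Q < q`, `(q, J) = 1` and `q ≤ Q · p` for every prime `p ∣ q`.
[cite: Ford2002, proof of Lemma 4.1 ("since every prime divisor of q is ≤ R, there is a divisor q_i of
x_i with q_i > P^{1/r}, q_i ∈ 𝒞(P^{1/r}R, R) and (q_i, J(x)) = 1")] -/
theorem exists_min_good_divisor {n J Qn : ℕ} (hn : n ≠ 0) (hJ : J ≠ 0) (hns : ¬ Special Qn J n) :
    ∃ q, q ∣ n ∧ Qn < q ∧ Nat.Coprime q J ∧ ∀ p ∈ q.primeFactors, q ≤ Qn * p := by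
  classical
  obtain ⟨q₀, hq₀n, hq₀Q, hq₀c⟩ := exists_coprime_divisor_gt hn hJ hns
  set T := n.divisors.filter fun d => Qn < d ∧ Nat.Coprime d J with hT
  have hne : T.Nonempty := ⟨q₀, by rw [hT, mem_filter, Nat.mem_divisors]; exact ⟨⟨hq₀n, hn⟩, hq₀Q, hq₀c⟩⟩
  set q := T.min' hne with hq
  have hmem : q ∈ T := Finset.min'_mem _ _
  rw [hT, mem_filter] at hmem
  obtain ⟨hdiv, hQ, hcop⟩ := hmem
  have hqn := Nat.dvd_of_mem_divisors hdiv
  refine ⟨q, hqn, hQ, hcop, fun p hp => ?_⟩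
  have hpp := Nat.prime_of_mem_primeFactors hp
  have hpq := Nat.dvd_of_mem_primeFactors hp
  have hq0 : 0 < q := Nat.pos_of_mem_divisors hdiv
  -- `q / p` is a smaller divisor coprime to `J`, hence `≤ Qn`
  have hle : q / p ≤ Qn := by
    by_contra hgt
    push Not at hgt
    have hmem' : q / p ∈ T := by
      rw [hT, mem_filter, Nat.mem_divisors]
      exact ⟨⟨(Nat.div_dvd_of_dvd hpq).trans hqn, hn⟩, hgt, hcop.coprime_dvd_left (Nat.div_dvd_of_dvd hpq)⟩
    have h1 : q ≤ q / p := Finset.min'_le _ _ hmem'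
    have h2 : q / p < q := Nat.div_lt_self hq0 hpp.one_lt
    omega
  calc q = q / p * p := (Nat.div_mul_cancel hpq).symm
    _ ≤ Qn * p := Nat.mul_le_mul_right _ hle

/-- The admissible divisors: `q ∈ (Q, Q⌊R⌋]` with all prime factors `> √R`. [cite: Ford2002, proof
of Lemma 4.1 ("q_i ∈ 𝒞(P^{1/r}R, R); p_i, q_i > P^{1/r}")] -/
def Qrange (R : ℝ) (Qn : ℕ) : Finset ℕ :=
  (Finset.Ioc Qn (Qn * ⌊R⌋₊)).filter fun q => ∀ p ∈ q.primeFactors, ⌊Real.sqrt R⌋₊ < p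

/-- Membership in `Qrange`. [folklore] -/
theorem mem_Qrange {R : ℝ} {Qn q : ℕ} : q ∈ Qrange R Qn ↔
    (Qn < q ∧ q ≤ Qn * ⌊R⌋₊) ∧ ∀ p ∈ q.primeFactors, Real.sqrt R < p := by
  rw [Qrange, mem_filter, Finset.mem_Ioc]
  refine and_congr Iff.rfl (forall₂_congr fun p _ => ?_)
  exact Nat.floor_lt (Real.sqrt_nonneg _)

/-- **Good divisors of members of `𝒞(P,R)`** land in `Qrange` and the cofactor lies in
`𝒞(P/q, R)`. [cite: Ford2002, proof of Lemma 4.1 (case S₄, "q_i ∈ 𝒞(P^{1/r}R, R)", "u_i ∈ 𝒞(P/q_i, R)")] -/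
theorem good_divisor_props {P R : ℝ} {n q Qn : ℕ} (hQn : 1 ≤ Qn) (hn : n ∈ smoothSet P R)
    (hqn : q ∣ n) (hQ : Qn < q) (hmin : ∀ p ∈ q.primeFactors, q ≤ Qn * p) :
    q ∈ Qrange R Qn ∧ n / q ∈ smoothSet (P / q) R := by
  have hn' := mem_smoothSet.1 hn
  have hn0 : n ≠ 0 := by omega
  have hq0 : q ≠ 0 := fun h0 => by rw [h0] at hqn; exact hn0 (zero_dvd_iff.1 hqn)
  have hqpf : ∀ p ∈ q.primeFactors, Real.sqrt R < p ∧ (p : ℝ) ≤ R := fun p hp =>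
    hn'.2.2 p (Nat.primeFactors_mono hqn hn0 hp)
  refine ⟨?_, ?_⟩
  · rw [mem_Qrange]
    refine ⟨⟨hQ, ?_⟩, fun p hp => (hqpf p hp).1⟩
    have hq2 : 2 ≤ q := by omega
    obtain ⟨p, hp⟩ : q.primeFactors.Nonempty := (Nat.nonempty_primeFactors).2 hq2
    have h1 := hmin p hp
    have h2 : p ≤ ⌊R⌋₊ := Nat.le_floor (hqpf p hp).2
    exact h1.trans (Nat.mul_le_mul_left _ h2)
  · have hnq := Nat.div_dvd_of_dvd hqn
    refine dvd_mem_smoothSet hn hnq ?_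
    rw [le_div_iff₀ (by exact_mod_cast Nat.pos_of_ne_zero hq0)]
    have : ((n / q : ℕ) : ℝ) * q = n := by exact_mod_cast Nat.div_mul_cancel hqn
    rw [this]; exact hn'.2.1

/-! ### The class `S₄` and its injection into the `(q⃗, p⃗)`-systems -/

section S4

variable (k h t m : ℕ) (B : Finset ℤ) (P R : ℝ) (Qn : ℕ)

/-- The class `S₄`: heads injective and no rest variable special. [cite: Ford2002, proof of Lemma 4.1
(definition of S₄)] -/
def SolS4 : Finset (((Fin t → ℤ) × (Fin m → ℤ)) × ((Fin t → ℤ) × (Fin m → ℤ))) :=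
  (SolS k h k t m B).filter fun p => Function.Injective p.1.1 ∧ Function.Injective p.2.1 ∧
    ∀ i : Fin m, ¬ Special Qn (JN p.1.1) (p.1.2 i).natAbs ∧ ¬ Special Qn (JN p.2.1) (p.2.2 i).natAbs

/-- `ℬ_q = 𝒞(P/q, R)` as a set of integers. [cite: Ford2002, (4.7)] -/
def Bq (q : ℕ) : Finset ℤ := (smoothSet (P / q) R).map Nat.castEmbedding

/-- Injective heads coprime to every `q_i`. [cite: Ford2002, proof of Lemma 4.1 (`F_q(α)`)] -/
def Xcop (qv : Fin m → ℕ) : Finset (Fin t → ℤ) :=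
  (tuplesInj t B).filter fun x => ∀ i, Nat.Coprime (qv i) (JN x)

/-- The `u`-variables: `u_i ∈ ℬ_{q_i}`. [folklore] -/
def U (qv : Fin m → ℕ) : Finset (Fin m → ℤ) := Fintype.piFinset fun i => Bq P R (qv i)

/-- Frequencies `s(x) + ∑_i ν(q_i u_i)`. [folklore] -/
def vXU (qv : Fin m → ℕ) (xu : (Fin t → ℤ) × (Fin m → ℤ)) : Fin k → ℤ :=
  psvR k h k xu.1 + ∑ i, nuR k h k ((qv i : ℤ) * xu.2 i)

/-- The count `N(q⃗, p⃗)` of the `(q⃗, p⃗)`-system. [cite: Ford2002, proof of Lemma 4.1 (the system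
defining `T`)] -/
def Ncount (qv pv : Fin m → ℕ) : ℕ :=
  (((Xcop t m B qv ×ˢ U m P R qv) ×ˢ (Xcop t m B pv ×ˢ U m P R pv)).filter fun ab =>
    vXU k h t m qv ab.1 = vXU k h t m pv ab.2).card

variable {k h t m B P R Qn}

/-- A good divisor for each non-special rest variable (and `1` otherwise). [folklore] -/
def qOf (Qn J n : ℕ) : ℕ :=
  if hc : n ≠ 0 ∧ J ≠ 0 ∧ ¬ Special Qn J n then
    Classical.choose (exists_min_good_divisor hc.1 hc.2.1 hc.2.2) else 1

/-- Properties of `qOf`. [folklore] -/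
theorem qOf_spec {Qn J n : ℕ} (hn : n ≠ 0) (hJ : J ≠ 0) (hns : ¬ Special Qn J n) :
    qOf Qn J n ∣ n ∧ Qn < qOf Qn J n ∧ Nat.Coprime (qOf Qn J n) J ∧
      ∀ p ∈ (qOf Qn J n).primeFactors, qOf Qn J n ≤ Qn * p := by
  have hc : n ≠ 0 ∧ J ≠ 0 ∧ ¬ Special Qn J n := ⟨hn, hJ, hns⟩
  simp only [qOf, dif_pos hc]
  exact Classical.choose_spec (exists_min_good_divisor hc.1 hc.2.1 hc.2.2)

/-- **`#S₄ ≤ ∑_{q⃗, p⃗} N(q⃗, p⃗)`.** [cite: Ford2002, proof of Lemma 4.1 ("Therefore S₀ ≤ 4T, where T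
is the number of solutions of …")] -/
theorem card_Sol4_le_sum (hQn : 1 ≤ Qn) :
    (SolS4 k h t m ((smoothSet P R).map Nat.castEmbedding) Qn).card
      ≤ ∑ qv ∈ Fintype.piFinset (fun _ : Fin m => Qrange R Qn),
          ∑ pv ∈ Fintype.piFinset (fun _ : Fin m => Qrange R Qn),
            Ncount k h t m ((smoothSet P R).map Nat.castEmbedding) P R qv pv := by
  classical
  set C := smoothSet P R with hC
  set B : Finset ℤ := C.map Nat.castEmbedding with hB
  have hBmem : ∀ z : ℤ, z ∈ B ↔ ∃ n ∈ C, (n : ℤ) = z := by intro z; rw [hB, mem_map]; rfl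
  have hBpos : ∀ z ∈ B, 1 ≤ z := by
    intro z hz; obtain ⟨n, hn, rfl⟩ := (hBmem z).1 hz; exact_mod_cast (mem_smoothSet.1 hn).1
  set S4 := SolS4 k h t m B Qn with hS4
  set Qr := Fintype.piFinset (fun _ : Fin m => Qrange R Qn) with hQr
  -- the q-vectors of a solution
  set qvec : (((Fin t → ℤ) × (Fin m → ℤ)) × ((Fin t → ℤ) × (Fin m → ℤ))) → (Fin m → ℕ) × (Fin m → ℕ) :=
    fun p => (fun i => qOf Qn (JN p.1.1) (p.1.2 i).natAbs, fun i => qOf Qn (JN p.2.1) (p.2.2 i).natAbs)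
    with hqvec
  -- facts about members of `S4`
  have hfacts : ∀ p ∈ S4, (∀ i, (p.1.2 i).natAbs ∈ C ∧ ((p.1.2 i).natAbs : ℤ) = p.1.2 i ∧
      (qOf Qn (JN p.1.1) (p.1.2 i).natAbs ∣ (p.1.2 i).natAbs ∧ Qn < qOf Qn (JN p.1.1) (p.1.2 i).natAbs ∧
        Nat.Coprime (qOf Qn (JN p.1.1) (p.1.2 i).natAbs) (JN p.1.1) ∧
        ∀ p' ∈ (qOf Qn (JN p.1.1) (p.1.2 i).natAbs).primeFactors,
          qOf Qn (JN p.1.1) (p.1.2 i).natAbs ≤ Qn * p')) ∧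
      (∀ i, (p.2.2 i).natAbs ∈ C ∧ ((p.2.2 i).natAbs : ℤ) = p.2.2 i ∧
      (qOf Qn (JN p.2.1) (p.2.2 i).natAbs ∣ (p.2.2 i).natAbs ∧ Qn < qOf Qn (JN p.2.1) (p.2.2 i).natAbs ∧
        Nat.Coprime (qOf Qn (JN p.2.1) (p.2.2 i).natAbs) (JN p.2.1) ∧
        ∀ p' ∈ (qOf Qn (JN p.2.1) (p.2.2 i).natAbs).primeFactors,
          qOf Qn (JN p.2.1) (p.2.2 i).natAbs ≤ Qn * p')) := by
    intro p hp
    rw [hS4, SolS4, mem_filter, mem_SolS] at hp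
    obtain ⟨⟨⟨hx, hr⟩, ⟨hy, hr'⟩, -⟩, hinjx, hinjy, hns⟩ := hp
    have hJx : JN p.1.1 ≠ 0 := by
      rw [JN]; exact Int.natAbs_ne_zero.2 (Jstar_ne_zero hinjx fun i h0 => by
        have := hBpos _ ((mem_tuples.1 hx) i); omega)
    have hJy : JN p.2.1 ≠ 0 := by
      rw [JN]; exact Int.natAbs_ne_zero.2 (Jstar_ne_zero hinjy fun i h0 => by
        have := hBpos _ ((mem_tuples.1 hy) i); omega)
    constructor
    · intro i
      have hmem := (mem_tuples.1 hr) i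
      obtain ⟨n, hnC, hn⟩ := (hBmem _).1 hmem
      have hnat : (p.1.2 i).natAbs = n := by rw [← hn, Int.natAbs_natCast]
      have hpos : ((p.1.2 i).natAbs : ℤ) = p.1.2 i := Int.natAbs_of_nonneg (by linarith [hBpos _ hmem])
      have hn0 : (p.1.2 i).natAbs ≠ 0 := by rw [hnat]; have := (mem_smoothSet.1 hnC).1; omega
      exact ⟨hnat ▸ hnC, hpos, qOf_spec hn0 hJx (hns i).1⟩
    · intro i
      have hmem := (mem_tuples.1 hr') i
      obtain ⟨n, hnC, hn⟩ := (hBmem _).1 hmem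
      have hnat : (p.2.2 i).natAbs = n := by rw [← hn, Int.natAbs_natCast]
      have hpos : ((p.2.2 i).natAbs : ℤ) = p.2.2 i := Int.natAbs_of_nonneg (by linarith [hBpos _ hmem])
      have hn0 : (p.2.2 i).natAbs ≠ 0 := by rw [hnat]; have := (mem_smoothSet.1 hnC).1; omega
      exact ⟨hnat ▸ hnC, hpos, qOf_spec hn0 hJy (hns i).2⟩
  -- `qvec` maps into `Qr × Qr`
  have hmaps : ∀ p ∈ S4, qvec p ∈ Qr ×ˢ Qr := by
    intro p hp
    obtain ⟨h1, h2⟩ := hfacts p hp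
    rw [mem_product, hQr, Fintype.mem_piFinset, Fintype.mem_piFinset]
    constructor
    · intro i
      obtain ⟨hnC, -, hdvd, hQ, -, hmin⟩ := h1 i
      exact (good_divisor_props hQn hnC hdvd hQ hmin).1
    · intro i
      obtain ⟨hnC, -, hdvd, hQ, -, hmin⟩ := h2 i
      exact (good_divisor_props hQn hnC hdvd hQ hmin).1
  rw [card_eq_sum_card_fiberwise hmaps, sum_product]
  refine sum_le_sum fun qv _ => sum_le_sum fun pv _ => ?_
  -- the fibre over `(qv, pv)` injects into the `(qv, pv)`-system
  set Φ : (((Fin t → ℤ) × (Fin m → ℤ)) × ((Fin t → ℤ) × (Fin m → ℤ))) →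
      (((Fin t → ℤ) × (Fin m → ℤ)) × ((Fin t → ℤ) × (Fin m → ℤ))) := fun p =>
    ((p.1.1, fun i => p.1.2 i / (qv i : ℤ)), (p.2.1, fun i => p.2.2 i / (pv i : ℤ))) with hΦ
  unfold Ncount
  refine card_le_card_of_injOn Φ (fun p hp => ?_) ?_
  · rw [mem_coe, mem_filter] at hp
    obtain ⟨hpS, hpq⟩ := hp
    have hqv : ∀ i, qOf Qn (JN p.1.1) (p.1.2 i).natAbs = qv i := fun i => by
      have := congrArg Prod.fst hpq; exact congr_fun this i
    have hpv : ∀ i, qOf Qn (JN p.2.1) (p.2.2 i).natAbs = pv i := fun i => by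
      have := congrArg Prod.snd hpq; exact congr_fun this i
    obtain ⟨h1, h2⟩ := hfacts p hpS
    have hpS' := hpS
    rw [hS4, SolS4, mem_filter, mem_SolS] at hpS'
    obtain ⟨⟨⟨hx, hr⟩, ⟨hy, hr'⟩, heq⟩, hinjx, hinjy, -⟩ := hpS'
    -- divisibility in `ℤ`
    have hdvdZ1 : ∀ i, (qv i : ℤ) ∣ p.1.2 i := fun i => by
      obtain ⟨-, hpos, hdvd, -⟩ := h1 i
      rw [← hpos, ← hqv i]; exact_mod_cast hdvd
    have hdvdZ2 : ∀ i, (pv i : ℤ) ∣ p.2.2 i := fun i => by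
      obtain ⟨-, hpos, hdvd, -⟩ := h2 i
      rw [← hpos, ← hpv i]; exact_mod_cast hdvd
    rw [mem_coe, mem_filter, mem_product, mem_product, mem_product]
    refine ⟨⟨⟨?_, ?_⟩, ?_, ?_⟩, ?_⟩
    · show p.1.1 ∈ Xcop t m B qv
      rw [Xcop, mem_filter, tuplesInj, mem_filter]
      refine ⟨⟨hx, hinjx⟩, fun i => ?_⟩
      rw [← hqv i]; exact (h1 i).2.2.2.2.1
    · show (fun i => p.1.2 i / (qv i : ℤ)) ∈ U m P R qv
      rw [U, Fintype.mem_piFinset]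
      intro i
      obtain ⟨hnC, hpos, hdvd, hQ, -, hmin⟩ := h1 i
      have hprops := good_divisor_props hQn hnC hdvd hQ hmin
      rw [Bq, mem_map]
      refine ⟨(p.1.2 i).natAbs / qOf Qn (JN p.1.1) (p.1.2 i).natAbs, ?_, ?_⟩
      · rw [hqv i] at hprops ⊢; exact hprops.2
      · show (((p.1.2 i).natAbs / qOf Qn (JN p.1.1) (p.1.2 i).natAbs : ℕ) : ℤ) = p.1.2 i / (qv i : ℤ)
        rw [Int.natCast_div, hpos, hqv i]
    · show p.2.1 ∈ Xcop t m B pv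
      rw [Xcop, mem_filter, tuplesInj, mem_filter]
      refine ⟨⟨hy, hinjy⟩, fun i => ?_⟩
      rw [← hpv i]; exact (h2 i).2.2.2.2.1
    · show (fun i => p.2.2 i / (pv i : ℤ)) ∈ U m P R pv
      rw [U, Fintype.mem_piFinset]
      intro i
      obtain ⟨hnC, hpos, hdvd, hQ, -, hmin⟩ := h2 i
      have hprops := good_divisor_props hQn hnC hdvd hQ hmin
      rw [Bq, mem_map]
      refine ⟨(p.2.2 i).natAbs / qOf Qn (JN p.2.1) (p.2.2 i).natAbs, ?_, ?_⟩
      · rw [hpv i] at hprops ⊢; exact hprops.2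
      · show (((p.2.2 i).natAbs / qOf Qn (JN p.2.1) (p.2.2 i).natAbs : ℕ) : ℤ) = p.2.2 i / (pv i : ℤ)
        rw [Int.natCast_div, hpos, hpv i]
    · -- the equation
      show vXU k h t m qv (p.1.1, fun i => p.1.2 i / (qv i : ℤ)) = vXU k h t m pv (p.2.1, fun i => p.2.2 i / (pv i : ℤ))
      simp only [vXU]
      have e1 : ∀ i, (qv i : ℤ) * (p.1.2 i / (qv i : ℤ)) = p.1.2 i := fun i => Int.mul_ediv_cancel' (hdvdZ1 i)
      have e2 : ∀ i, (pv i : ℤ) * (p.2.2 i / (pv i : ℤ)) = p.2.2 i := fun i => Int.mul_ediv_cancel' (hdvdZ2 i)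
      simp only [e1, e2, ← psvR_eq_sum_nuR]
      exact heq
  · -- injectivity on the fibre
    intro p hp p' hp' hpp'
    rw [mem_coe, mem_filter] at hp hp'
    obtain ⟨h1, -⟩ := hfacts p hp.1
    obtain ⟨h1', -⟩ := hfacts p' hp'.1
    obtain ⟨-, h2⟩ := hfacts p hp.1
    obtain ⟨-, h2'⟩ := hfacts p' hp'.1
    have hqv : ∀ i, qOf Qn (JN p.1.1) (p.1.2 i).natAbs = qv i := fun i => by
      have := congrArg Prod.fst hp.2; exact congr_fun this i
    have hqv' : ∀ i, qOf Qn (JN p'.1.1) (p'.1.2 i).natAbs = qv i := fun i => by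
      have := congrArg Prod.fst hp'.2; exact congr_fun this i
    have hpv : ∀ i, qOf Qn (JN p.2.1) (p.2.2 i).natAbs = pv i := fun i => by
      have := congrArg Prod.snd hp.2; exact congr_fun this i
    have hpv' : ∀ i, qOf Qn (JN p'.2.1) (p'.2.2 i).natAbs = pv i := fun i => by
      have := congrArg Prod.snd hp'.2; exact congr_fun this i
    simp only [hΦ, Prod.mk.injEq] at hpp'
    obtain ⟨⟨hx, hu⟩, hy, hv⟩ := hpp'
    have hr : p.1.2 = p'.1.2 := by
      funext i
      have hd : (qv i : ℤ) ∣ p.1.2 i := by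
        obtain ⟨-, hpos, hdvd, -⟩ := h1 i; rw [← hpos, ← hqv i]; exact_mod_cast hdvd
      have hd' : (qv i : ℤ) ∣ p'.1.2 i := by
        obtain ⟨-, hpos, hdvd, -⟩ := h1' i; rw [← hpos, ← hqv' i]; exact_mod_cast hdvd
      have := congr_fun hu i
      rw [← Int.mul_ediv_cancel' hd, ← Int.mul_ediv_cancel' hd', this]
    have hr' : p.2.2 = p'.2.2 := by
      funext i
      have hd : (pv i : ℤ) ∣ p.2.2 i := by
        obtain ⟨-, hpos, hdvd, -⟩ := h2 i; rw [← hpos, ← hpv i]; exact_mod_cast hdvd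
      have hd' : (pv i : ℤ) ∣ p'.2.2 i := by
        obtain ⟨-, hpos, hdvd, -⟩ := h2' i; rw [← hpos, ← hpv' i]; exact_mod_cast hdvd
      have := congr_fun hv i
      rw [← Int.mul_ediv_cancel' hd, ← Int.mul_ediv_cancel' hd', this]
    exact Prod.ext (Prod.ext hx hr) (Prod.ext hy hr')

end S4


/-! ### Hölder: `N(q⃗, p⃗) ≤ ∏ W(q_i)^{1/2m} ∏ W(p_i)^{1/2m}` -/

section Holder

variable {k h t m : ℕ} {B : Finset ℤ} {P R : ℝ}

/-- The `u`-part of the sum factors: `∑_{u ∈ U} e(α·∑_i ν(q_i u_i)) = ∏_i f_{q_i}(α)`. [folklore] -/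
theorem tp_U_eq_prod (qv : Fin m → ℕ) (α : Fin k → ℝ) :
    tp (U m P R qv) (fun u => ∑ i, nuR k h k ((qv i : ℤ) * u i)) α
      = ∏ i, tp (Bq P R (qv i)) (fun u => nuR k h k ((qv i : ℤ) * u)) α := by
  rw [U, prod_tp_eq]

/-- `f_q(α)^m = ∑_{u ∈ ℬ_q^m} e(α · scale q (s(u)))`. [folklore] -/
theorem tp_Bq_pow (q : ℕ) (α : Fin k → ℝ) :
    (tp (Bq P R q) (fun u => nuR k h k ((q : ℤ) * u)) α) ^ m
      = tp (tuples m (Bq P R q)) (fun u => scale (q : ℤ) (psvR k h k u)) α := by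
  have hh := prod_tp_eq (n := k) (m := m) (fun _ => Bq P R q) (fun _ => fun u => nuR k h k ((q : ℤ) * u)) α
  rw [prod_const, card_univ, Fintype.card_fin] at hh
  rw [hh]
  unfold tuples
  congr 1
  funext u
  exact sum_nuR_mul_eq_scale (q : ℤ) u

/-- **`∫ |F_{q⃗}|² |f_{q_i}|^{2m} ≤ W(q_i)`** (the count grows with the index set).
[cite: Ford2002, proof of Lemma 4.1 ("We have ∫ X_i(α) dα ≤ W(q_i)")] -/
theorem integral_F_sq_f_pow_le_W (qv : Fin m → ℕ) (i : Fin m) :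
    ∫ α in box k, ‖tp (Xcop t m B qv) (psvR k h k) α‖ ^ 2
        * ‖tp (Bq P R (qv i)) (fun u => nuR k h k ((qv i : ℤ) * u)) α‖ ^ (2 * m)
      ≤ (Wcount k h t m B (qv i) (Bq P R (qv i)) : ℝ) := by
  set q := qv i with hq
  have e : ∀ α : Fin k → ℝ, ‖tp (Xcop t m B qv) (psvR k h k) α‖ ^ 2
      * ‖tp (Bq P R q) (fun u => nuR k h k ((q : ℤ) * u)) α‖ ^ (2 * m)
      = ‖tp (Xcop t m B qv ×ˢ tuples m (Bq P R q))
          (fun xu => psvR k h k xu.1 + scale (q : ℤ) (psvR k h k xu.2)) α‖ ^ 2 := by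
    intro α
    rw [show tp (Xcop t m B qv ×ˢ tuples m (Bq P R q))
        (fun xu => psvR k h k xu.1 + scale (q : ℤ) (psvR k h k xu.2)) α
        = tp (Xcop t m B qv) (psvR k h k) α * tp (tuples m (Bq P R q)) (fun u => scale (q : ℤ) (psvR k h k u)) α
        from (tp_mul (Xcop t m B qv) (tuples m (Bq P R q)) (psvR k h k)
          (fun u => scale (q : ℤ) (psvR k h k u)) α).symm,
      ← tp_Bq_pow, norm_mul, norm_pow, mul_pow, ← pow_mul, mul_comm m 2]
  simp_rw [e]
  rw [integral_norm_sq_tp]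
  unfold Wcount
  exact_mod_cast card_le_card fun pp hpp => by
    rw [mem_filter, mem_product, mem_product, mem_product] at hpp ⊢
    refine ⟨⟨⟨?_, hpp.1.1.2⟩, ?_, hpp.1.2.2⟩, hpp.2⟩
    · have := hpp.1.1.1; rw [Xcop, mem_filter] at this; rw [X1, mem_filter]; exact ⟨this.1, this.2 i⟩
    · have := hpp.1.2.1; rw [Xcop, mem_filter] at this; rw [X1, mem_filter]; exact ⟨this.1, this.2 i⟩

/-- `(a² b^{2m})^{1/(2m)} = a^{1/m} b` for `a, b ≥ 0`, `m ≥ 1`. [folklore] -/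
theorem rpow_aux {a b : ℝ} (ha : 0 ≤ a) (hb : 0 ≤ b) (hm : 1 ≤ m) :
    (a ^ 2 * b ^ (2 * m)) ^ (1 / (2 * (m : ℝ))) = a ^ (1 / (m : ℝ)) * b := by
  have hm0 : (0 : ℝ) < m := by exact_mod_cast hm
  rw [Real.mul_rpow (by positivity) (by positivity)]
  congr 1
  · rw [← Real.rpow_natCast, ← Real.rpow_mul ha]; congr 1; push_cast; field_simp
  · rw [← Real.rpow_natCast, ← Real.rpow_mul hb]
    have : ((2 * m : ℕ) : ℝ) * (1 / (2 * (m : ℝ))) = 1 := by push_cast; field_simp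
    rw [this, Real.rpow_one]

/-- `∏_{i < m} a^{1/m} = a`. [folklore] -/
theorem prod_rpow_inv (a : ℝ) (ha : 0 ≤ a) (hm : 1 ≤ m) : ∏ _i : Fin m, a ^ (1 / (m : ℝ)) = a := by
  have hm0 : (0 : ℝ) < m := by exact_mod_cast hm
  rw [prod_const, card_univ, Fintype.card_fin, ← Real.rpow_natCast, ← Real.rpow_mul ha]
  have : 1 / (m : ℝ) * (m : ℕ) = 1 := by field_simp
  rw [this, Real.rpow_one]

/-- **`N(q⃗, p⃗) ≤ ∏_i W(q_i)^{1/2m} ∏_i W(p_i)^{1/2m}`** by Hölder's inequality with `2m` factors.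
[cite: Ford2002, proof of Lemma 4.1 ((4.8) and the preceding display)] -/
theorem Ncount_le_prod (hm : 1 ≤ m) (qv pv : Fin m → ℕ) :
    (Ncount k h t m B P R qv pv : ℝ)
      ≤ (∏ i, (Wcount k h t m B (qv i) (Bq P R (qv i)) : ℝ) ^ (1 / (2 * (m : ℝ))))
        * ∏ i, (Wcount k h t m B (pv i) (Bq P R (pv i)) : ℝ) ^ (1 / (2 * (m : ℝ))) := by
  -- the exponential sums
  set F : (Fin m → ℕ) → (Fin k → ℝ) → ℂ := fun w => tp (Xcop t m B w) (psvR k h k) with hF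
  set f : ℕ → (Fin k → ℝ) → ℂ := fun q => tp (Bq P R q) (fun u => nuR k h k ((q : ℤ) * u)) with hf
  -- Step 1: count ≤ ∫ |F_q ∏ f| |F_p ∏ f|
  have h1 := card_filter_eq_le_integral (n := k) (Xcop t m B qv ×ˢ U m P R qv) (Xcop t m B pv ×ˢ U m P R pv)
    (vXU k h t m qv) (vXU k h t m pv)
  have h1' : (Ncount k h t m B P R qv pv : ℝ) ≤ _ := h1
  have hside : ∀ (w : Fin m → ℕ) (α : Fin k → ℝ), ‖tp (Xcop t m B w ×ˢ U m P R w) (vXU k h t m w) α‖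
      = ‖F w α‖ * ∏ i, ‖f (w i) α‖ := by
    intro w α
    rw [show tp (Xcop t m B w ×ˢ U m P R w) (vXU k h t m w) α
        = F w α * tp (U m P R w) (fun u => ∑ i, nuR k h k ((w i : ℤ) * u i)) α
        from (tp_mul (Xcop t m B w) (U m P R w) (psvR k h k)
          (fun u => ∑ i, nuR k h k ((w i : ℤ) * u i)) α).symm, tp_U_eq_prod, norm_mul, norm_prod]
  simp_rw [hside] at h1'
  refine h1'.trans ?_
  -- Step 2: Hölder with index set `Fin m ⊕ Fin m`
  set Z : Fin m ⊕ Fin m → (Fin k → ℝ) → ℝ := fun l => Sum.elim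
    (fun i α => ‖F qv α‖ ^ 2 * ‖f (qv i) α‖ ^ (2 * m))
    (fun i α => ‖F pv α‖ ^ 2 * ‖f (pv i) α‖ ^ (2 * m)) l with hZ
  have hZc : ∀ l, Continuous (Z l) := by
    intro l; cases l with
    | inl i => exact ((continuous_tp _ _).norm.pow _).mul ((continuous_tp _ _).norm.pow _)
    | inr i => exact ((continuous_tp _ _).norm.pow _).mul ((continuous_tp _ _).norm.pow _)
  have hZ0 : ∀ l α, 0 ≤ Z l α := by
    intro l α; cases l with
    | inl i => simp only [hZ, Sum.elim_inl]; positivity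
    | inr i => simp only [hZ, Sum.elim_inr]; positivity
  have hm0 : (0 : ℝ) < m := by exact_mod_cast hm
  have hpsum : ∑ _l : Fin m ⊕ Fin m, (1 / (2 * (m : ℝ))) = 1 := by
    rw [sum_const, card_univ, Fintype.card_sum, Fintype.card_fin, nsmul_eq_mul]
    push_cast; field_simp; ring
  have hH := integral_prod_rpow_le_box (n := k) (univ : Finset (Fin m ⊕ Fin m)) (Z := Z)
    (fun l _ => hZc l) (fun l _ => hZ0 l) (p := fun _ => 1 / (2 * (m : ℝ))) hpsum
    (fun _ _ => by positivity)
  -- the integrand of `hH` is ours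
  have hint : ∀ α, (‖F qv α‖ * ∏ i, ‖f (qv i) α‖) * (‖F pv α‖ * ∏ i, ‖f (pv i) α‖)
      = ∏ l : Fin m ⊕ Fin m, Z l α ^ (1 / (2 * (m : ℝ))) := by
    intro α
    rw [Fintype.prod_sum_type]
    simp only [hZ, Sum.elim_inl, Sum.elim_inr]
    have key : ∀ w : Fin m → ℕ, (∏ i, (‖F w α‖ ^ 2 * ‖f (w i) α‖ ^ (2 * m)) ^ (1 / (2 * (m : ℝ))))
        = ‖F w α‖ * ∏ i, ‖f (w i) α‖ := fun w => by
      simp_rw [rpow_aux (norm_nonneg _) (norm_nonneg _) hm, prod_mul_distrib,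
        prod_rpow_inv _ (norm_nonneg _) hm]
    rw [key qv, key pv]
  simp_rw [hint]
  refine hH.trans ?_
  -- Step 3: each `∫ Z_l ≤ W`
  rw [Fintype.prod_sum_type]
  simp only [hZ, Sum.elim_inl, Sum.elim_inr]
  have hle : ∀ (w : Fin m → ℕ) (i : Fin m), (∫ α in box k, ‖F w α‖ ^ 2 * ‖f (w i) α‖ ^ (2 * m)) ^ (1 / (2 * (m : ℝ)))
      ≤ (Wcount k h t m B (w i) (Bq P R (w i)) : ℝ) ^ (1 / (2 * (m : ℝ))) := fun w i =>
    Real.rpow_le_rpow (integral_nonneg fun α => by positivity) (integral_F_sq_f_pow_le_W w i) (by positivity)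
  exact mul_le_mul (prod_le_prod (fun i _ => by positivity) fun i _ => hle qv i)
    (prod_le_prod (fun i _ => by positivity) fun i _ => hle pv i)
    (prod_nonneg fun i _ => by positivity) (prod_nonneg fun i _ => by positivity)

/-- **`#S₄ ≤ (∑_{Q<q≤QR} W(q)^{1/2m})^{2m}`.** [cite: Ford2002, (4.8)] -/
theorem card_Sol4_le_pow (hm : 1 ≤ m) {Qn : ℕ} (hQn : 1 ≤ Qn) :
    ((SolS4 k h t m ((smoothSet P R).map Nat.castEmbedding) Qn).card : ℝ)
      ≤ (∑ q ∈ Qrange R Qn, (Wcount k h t m ((smoothSet P R).map Nat.castEmbedding) q (Bq P R q) : ℝ)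
          ^ (1 / (2 * (m : ℝ)))) ^ (2 * m) := by
  set B : Finset ℤ := (smoothSet P R).map Nat.castEmbedding with hB
  set w : ℕ → ℝ := fun q => (Wcount k h t m B q (Bq P R q) : ℝ) ^ (1 / (2 * (m : ℝ))) with hw
  have h1 := card_Sol4_le_sum (k := k) (h := h) (t := t) (m := m) (P := P) (R := R) hQn
  rw [← hB] at h1
  calc ((SolS4 k h t m B Qn).card : ℝ)
      ≤ ∑ qv ∈ Fintype.piFinset (fun _ : Fin m => Qrange R Qn),
          ∑ pv ∈ Fintype.piFinset (fun _ : Fin m => Qrange R Qn), (Ncount k h t m B P R qv pv : ℝ) := by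
        exact_mod_cast h1
    _ ≤ ∑ qv ∈ Fintype.piFinset (fun _ : Fin m => Qrange R Qn),
          ∑ pv ∈ Fintype.piFinset (fun _ : Fin m => Qrange R Qn), (∏ i, w (qv i)) * ∏ i, w (pv i) :=
        sum_le_sum fun qv _ => sum_le_sum fun pv _ => Ncount_le_prod hm qv pv
    _ = (∑ qv ∈ Fintype.piFinset (fun _ : Fin m => Qrange R Qn), ∏ i, w (qv i))
          * ∑ pv ∈ Fintype.piFinset (fun _ : Fin m => Qrange R Qn), ∏ i, w (pv i) := by
        rw [sum_mul_sum]
    _ = (∑ q ∈ Qrange R Qn, w q) ^ m * (∑ q ∈ Qrange R Qn, w q) ^ m := by rw [← sum_pow']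
    _ = (∑ q ∈ Qrange R Qn, w q) ^ (2 * m) := by rw [← pow_add, two_mul]

end Holder


end FordVK
end Literature.NumberTheory.LFunctions
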